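import Mathlib

/-!
# Positive association from a monotone Gibbs sampler — the support-aware finite lemma (blind cell
PercRepro2, p3 g12, 2026-08-27; `proofs/P3-G2.md` §3, steps 1–4)

The companion of `GibbsPA.lean` in the form the percolation instantiation needs: the probability
vector `q` may vanish outside its support, the kernel `T` is only constrained on the rows of the
support — each such row is stochastic, vanishes off the support, and is MINORISED by `q`
(`δ * q u ≤ T s u`) — and the class `Inc` is closed under `T` with a covariance-decreasing step.
Then every two functions of the class are positively correlated under `q`
(`cov_nonneg_of_gibbs`).  Oscillations are measured on the support only (`OscOn`), the Doeblin
factor is `1 − δ`.  Own work; standard axioms; `Mathlib` only.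
-/

namespace Summit.Ventures.PercRepro2

namespace GibbsPAq

open Finset

variable {S : Type*} [Fintype S]

/-- The covariance of `f` and `g` under the weights `q`. -/
def cov (q f g : S → ℝ) : ℝ :=
  (∑ s, q s * (f s * g s)) - (∑ s, q s * f s) * (∑ s, q s * g s)

/-- The kernel `T` applied to `g`: `(kap T g) s = ∑ u, T s u * g u`. -/
def kap (T : S → S → ℝ) (g : S → ℝ) : S → ℝ := fun s => ∑ u, T s u * g u

/-- `OscOn q h M`: on the support of `q`, every difference of two values of `h` is at most `M`. -/
def OscOn (q h : S → ℝ) (M : ℝ) : Prop := ∀ s s', q s ≠ 0 → q s' ≠ 0 → h s - h s' ≤ M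

/-- A probability vector has a non-empty support. -/
theorem exists_ne_zero_of_sum_eq_one (q : S → ℝ) (hq1 : ∑ s, q s = 1) : ∃ s, q s ≠ 0 := by
  by_contra h
  have h' : ∀ s, q s = 0 := fun s => by
    by_contra hs
    exact h ⟨s, hs⟩
  simp [h'] at hq1

/-- Centring. -/
theorem cov_eq_centered (q f g : S → ℝ) (hq1 : ∑ s, q s = 1) :
    cov q f g = ∑ s, q s * ((f s - ∑ u, q u * f u) * (g s - ∑ u, q u * g u)) := by
  unfold cov
  set mf := ∑ u, q u * f u with hmf
  set mg := ∑ u, q u * g u with hmg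
  have h1 : ∑ s, q s * ((f s - mf) * (g s - mg)) =
      ∑ s, (q s * (f s * g s) - mg * (q s * f s) - mf * (q s * g s) + (mf * mg) * q s) := by
    apply Finset.sum_congr rfl
    intro s _
    ring
  rw [h1, Finset.sum_add_distrib, Finset.sum_sub_distrib, Finset.sum_sub_distrib,
    ← Finset.mul_sum, ← Finset.mul_sum, ← Finset.mul_sum, hq1]
  rw [← hmf, ← hmg]
  ring

/-- On the support, a value of `h` differs from its `q`-mean by at most the oscillation bound. -/
theorem abs_sub_mean_le {q h : S → ℝ} {M : ℝ} (hM : OscOn q h M) (hq0 : ∀ s, 0 ≤ q s)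
    (hq1 : ∑ s, q s = 1) {s : S} (hs : q s ≠ 0) : |h s - ∑ u, q u * h u| ≤ M := by
  have hrepr : h s - ∑ u, q u * h u = ∑ u, q u * (h s - h u) := by
    have : ∑ u, q u * (h s - h u) = (∑ u, q u) * h s - ∑ u, q u * h u := by
      rw [Finset.sum_mul, ← Finset.sum_sub_distrib]
      apply Finset.sum_congr rfl
      intro u _
      ring
    rw [this, hq1, one_mul]
  rw [hrepr, abs_le]
  constructor
  · have : -M = ∑ u, q u * (-M) := by rw [← Finset.sum_mul, hq1, one_mul]
    rw [this]
    apply Finset.sum_le_sum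
    intro u _
    by_cases hu : q u = 0
    · simp [hu]
    · apply mul_le_mul_of_nonneg_left _ (hq0 u)
      have := hM u s hu hs
      linarith
  · have : M = ∑ u, q u * M := by rw [← Finset.sum_mul, hq1, one_mul]
    rw [this]
    apply Finset.sum_le_sum
    intro u _
    by_cases hu : q u = 0
    · simp [hu]
    · exact mul_le_mul_of_nonneg_left (hM s u hs hu) (hq0 u)

/-- A covariance is at least minus the product of the two oscillation bounds. -/
theorem neg_mul_osc_le_cov {q h₁ h₂ : S → ℝ} {M₁ M₂ : ℝ} (hM₁ : OscOn q h₁ M₁)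
    (hM₂ : OscOn q h₂ M₂) (hq0 : ∀ s, 0 ≤ q s) (hq1 : ∑ s, q s = 1) :
    -(M₁ * M₂) ≤ cov q h₁ h₂ := by
  obtain ⟨s₀, hs₀⟩ := exists_ne_zero_of_sum_eq_one q hq1
  have hM₁0 : 0 ≤ M₁ := le_trans (abs_nonneg _) (abs_sub_mean_le hM₁ hq0 hq1 hs₀)
  have hM₂0 : 0 ≤ M₂ := le_trans (abs_nonneg _) (abs_sub_mean_le hM₂ hq0 hq1 hs₀)
  rw [cov_eq_centered q h₁ h₂ hq1]
  have : -(M₁ * M₂) = ∑ s, q s * (-(M₁ * M₂)) := by rw [← Finset.sum_mul, hq1, one_mul]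
  rw [this]
  apply Finset.sum_le_sum
  intro s _
  by_cases hs : q s = 0
  · simp [hs]
  apply mul_le_mul_of_nonneg_left _ (hq0 s)
  have e1 := abs_sub_mean_le hM₁ hq0 hq1 hs
  have e2 := abs_sub_mean_le hM₂ hq0 hq1 hs
  have habs : |(h₁ s - ∑ u, q u * h₁ u) * (h₂ s - ∑ u, q u * h₂ u)| ≤ M₁ * M₂ := by
    rw [abs_mul]
    exact mul_le_mul e1 e2 (abs_nonneg _) hM₁0
  exact (abs_le.mp habs).1

/-- Any function has oscillation at most twice the sum of its absolute values. -/
theorem osc_two_sum_abs (q g : S → ℝ) : OscOn q g (2 * ∑ s, |g s|) := by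
  intro s s' _ _
  have h1 : |g s| ≤ ∑ u, |g u| :=
    Finset.single_le_sum (fun u _ => abs_nonneg (g u)) (Finset.mem_univ s)
  have h2 : |g s'| ≤ ∑ u, |g u| :=
    Finset.single_le_sum (fun u _ => abs_nonneg (g u)) (Finset.mem_univ s')
  have := abs_sub (g s) (g s')
  have h3 : g s - g s' ≤ |g s - g s'| := le_abs_self _
  linarith

/-- The Doeblin contraction on the support: a kernel whose support rows are stochastic,
vanish off the support and are minorised by `δ·q` contracts the oscillation by `1 − δ`. -/
theorem osc_kap {q : S → ℝ} (hq1 : ∑ s, q s = 1) {T : S → S → ℝ} {δ : ℝ}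
    (hrow : ∀ s, q s ≠ 0 → ∑ u, T s u = 1) (hmin : ∀ s u, q s ≠ 0 → δ * q u ≤ T s u)
    (hsupp : ∀ s u, q s ≠ 0 → q u = 0 → T s u = 0) {h : S → ℝ} {M : ℝ} (hM : OscOn q h M) :
    OscOn q (kap T h) ((1 - δ) * M) := by
  intro s s' hs hs'
  -- maximiser and minimiser of `h` on the support
  have hne : (Finset.univ.filter (fun u => q u ≠ 0)).Nonempty :=
    ⟨s, by simp [hs]⟩
  obtain ⟨u₀, hu₀mem, hu₀⟩ := Finset.exists_max_image _ h hne
  obtain ⟨v₀, hv₀mem, hv₀⟩ := Finset.exists_min_image _ h hne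
  have hu₀q : q u₀ ≠ 0 := (Finset.mem_filter.mp hu₀mem).2
  have hv₀q : q v₀ ≠ 0 := (Finset.mem_filter.mp hv₀mem).2
  set ρ := 1 - δ with hρ
  have hsum : ∀ t, q t ≠ 0 → ∑ u, (T t u - δ * q u) = ρ := by
    intro t ht
    rw [Finset.sum_sub_distrib, hrow t ht, ← Finset.mul_sum, hq1, hρ]
    ring
  have hnn : ∀ t u, q t ≠ 0 → 0 ≤ T t u - δ * q u := fun t u ht => sub_nonneg.mpr (hmin t u ht)
  have hkap : ∀ t, kap T h t = (∑ u, (T t u - δ * q u) * h u) + δ * ∑ u, q u * h u := by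
    intro t
    unfold kap
    rw [Finset.mul_sum, ← Finset.sum_add_distrib]
    apply Finset.sum_congr rfl
    intro u _
    ring
  -- termwise: off the support the coefficient vanishes, on the support `h u ≤ h u₀`
  have hup : ∑ u, (T s u - δ * q u) * h u ≤ ρ * h u₀ := by
    rw [← hsum s hs, Finset.sum_mul]
    apply Finset.sum_le_sum
    intro u _
    by_cases hu : q u = 0
    · rw [hsupp s u hs hu, hu]; simp
    · exact mul_le_mul_of_nonneg_left (hu₀ u (by simp [hu])) (hnn s u hs)
  have hlow : ρ * h v₀ ≤ ∑ u, (T s' u - δ * q u) * h u := by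
    rw [← hsum s' hs', Finset.sum_mul]
    apply Finset.sum_le_sum
    intro u _
    by_cases hu : q u = 0
    · rw [hsupp s' u hs' hu, hu]; simp
    · exact mul_le_mul_of_nonneg_left (hv₀ u (by simp [hu])) (hnn s' u hs')
  have hρ0 : 0 ≤ ρ := by
    rw [← hsum s hs]
    exact Finset.sum_nonneg (fun u _ => hnn s u hs)
  have hosc : h u₀ - h v₀ ≤ M := hM u₀ v₀ hu₀q hv₀q
  have : ρ * (h u₀ - h v₀) ≤ ρ * M := mul_le_mul_of_nonneg_left hosc hρ0
  rw [hkap s, hkap s']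
  linarith [mul_sub ρ (h u₀) (h v₀)]

/-- Iterates contract the oscillation bound geometrically. -/
theorem osc_iterate {q : S → ℝ} (hq1 : ∑ s, q s = 1) {T : S → S → ℝ} {δ : ℝ}
    (hrow : ∀ s, q s ≠ 0 → ∑ u, T s u = 1) (hmin : ∀ s u, q s ≠ 0 → δ * q u ≤ T s u)
    (hsupp : ∀ s u, q s ≠ 0 → q u = 0 → T s u = 0) {g : S → ℝ} {M : ℝ} (hM : OscOn q g M)
    (n : ℕ) : OscOn q ((kap T)^[n] g) ((1 - δ) ^ n * M) := by
  induction n with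
  | zero => simpa using hM
  | succ n ih =>
    rw [Function.iterate_succ_apply', pow_succ]
    have := osc_kap hq1 hrow hmin hsupp ih
    rw [show (1 - δ) ^ n * (1 - δ) * M = (1 - δ) * ((1 - δ) ^ n * M) by ring]
    exact this

/-- The covariance-decrease step, iterated. -/
theorem cov_iterate_le (q : S → ℝ) (T : S → S → ℝ) (Inc : (S → ℝ) → Prop)
    (hIncT : ∀ g, Inc g → Inc (kap T g))
    (hdec : ∀ g₁ g₂, Inc g₁ → Inc g₂ → cov q (kap T g₁) (kap T g₂) ≤ cov q g₁ g₂)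
    (g₁ g₂ : S → ℝ) (h₁ : Inc g₁) (h₂ : Inc g₂) (n : ℕ) :
    Inc ((kap T)^[n] g₁) ∧ Inc ((kap T)^[n] g₂) ∧
      cov q ((kap T)^[n] g₁) ((kap T)^[n] g₂) ≤ cov q g₁ g₂ := by
  induction n with
  | zero => exact ⟨h₁, h₂, le_rfl⟩
  | succ n ih =>
    obtain ⟨i₁, i₂, hc⟩ := ih
    refine ⟨?_, ?_, ?_⟩
    · rw [Function.iterate_succ_apply']; exact hIncT _ i₁
    · rw [Function.iterate_succ_apply']; exact hIncT _ i₂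
    · rw [Function.iterate_succ_apply', Function.iterate_succ_apply']
      exact le_trans (hdec _ _ i₁ i₂) hc

/-- **Positive association from a monotone Gibbs sampler (support-aware form).** `q` a
probability vector on the finite type `S`; `T` a kernel whose support rows are stochastic, vanish
off the support and are minorised by `δ·q` with `δ > 0`; `Inc` a class of functions closed under
`T` on which one step does not increase the covariance.  Then the covariance of any two functions
of the class is non-negative. -/
theorem cov_nonneg_of_gibbs (q : S → ℝ) (hq0 : ∀ s, 0 ≤ q s) (hq1 : ∑ s, q s = 1)
    (T : S → S → ℝ) (δ : ℝ) (hδ : 0 < δ)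
    (hrow : ∀ s, q s ≠ 0 → ∑ u, T s u = 1) (hmin : ∀ s u, q s ≠ 0 → δ * q u ≤ T s u)
    (hsupp : ∀ s u, q s ≠ 0 → q u = 0 → T s u = 0)
    (Inc : (S → ℝ) → Prop) (hIncT : ∀ g, Inc g → Inc (kap T g))
    (hdec : ∀ g₁ g₂, Inc g₁ → Inc g₂ → cov q (kap T g₁) (kap T g₂) ≤ cov q g₁ g₂)
    (g₁ g₂ : S → ℝ) (h₁ : Inc g₁) (h₂ : Inc g₂) : 0 ≤ cov q g₁ g₂ := by
  set ρ := 1 - δ with hρ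
  have hρ1 : ρ < 1 := by rw [hρ]; linarith
  have hρ0 : 0 ≤ ρ := by
    obtain ⟨s₀, hs₀⟩ := exists_ne_zero_of_sum_eq_one q hq1
    have h1 : ∑ u, δ * q u ≤ ∑ u, T s₀ u := Finset.sum_le_sum (fun u _ => hmin s₀ u hs₀)
    rw [hrow s₀ hs₀, ← Finset.mul_sum, hq1, mul_one] at h1
    rw [hρ]
    linarith
  set M₁ := 2 * ∑ s, |g₁ s| with hM₁
  set M₂ := 2 * ∑ s, |g₂ s| with hM₂
  have hM₁0 : 0 ≤ M₁ := by
    rw [hM₁]; exact mul_nonneg (by norm_num) (Finset.sum_nonneg (fun s _ => abs_nonneg _))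
  have hM₂0 : 0 ≤ M₂ := by
    rw [hM₂]; exact mul_nonneg (by norm_num) (Finset.sum_nonneg (fun s _ => abs_nonneg _))
  have key : ∀ n : ℕ, -(ρ ^ n * M₁ * (ρ ^ n * M₂)) ≤ cov q g₁ g₂ := by
    intro n
    obtain ⟨-, -, hc⟩ := cov_iterate_le q T Inc hIncT hdec g₁ g₂ h₁ h₂ n
    have o₁ := osc_iterate hq1 hrow hmin hsupp (osc_two_sum_abs q g₁) n
    have o₂ := osc_iterate hq1 hrow hmin hsupp (osc_two_sum_abs q g₂) n
    rw [← hρ, ← hM₁] at o₁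
    rw [← hρ, ← hM₂] at o₂
    exact le_trans (neg_mul_osc_le_cov o₁ o₂ hq0 hq1) hc
  by_contra hneg
  have hneg' : cov q g₁ g₂ < 0 := not_le.mp hneg
  set ε := -cov q g₁ g₂ with hε
  have hε0 : 0 < ε := by rw [hε]; linarith
  have hpos : 0 < ε / (M₁ * M₂ + 1) := by
    apply div_pos hε0
    have := mul_nonneg hM₁0 hM₂0
    linarith
  obtain ⟨n, hn⟩ := exists_pow_lt_of_lt_one hpos hρ1
  have hρn0 : 0 ≤ ρ ^ n := pow_nonneg hρ0 n
  have hρn1 : ρ ^ n ≤ 1 := pow_le_one₀ hρ0 (le_of_lt hρ1)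
  have hbound : ρ ^ n * M₁ * (ρ ^ n * M₂) ≤ ρ ^ n * (M₁ * M₂) := by
    have : ρ ^ n * M₁ * (ρ ^ n * M₂) = (ρ ^ n * ρ ^ n) * (M₁ * M₂) := by ring
    rw [this]
    apply mul_le_mul_of_nonneg_right _ (mul_nonneg hM₁0 hM₂0)
    calc ρ ^ n * ρ ^ n ≤ ρ ^ n * 1 := mul_le_mul_of_nonneg_left hρn1 hρn0
      _ = ρ ^ n := mul_one _
  have hsmall : ρ ^ n * (M₁ * M₂) < ε := by
    have hM12 : M₁ * M₂ < M₁ * M₂ + 1 := by linarith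
    have hM120 : 0 ≤ M₁ * M₂ := mul_nonneg hM₁0 hM₂0
    calc ρ ^ n * (M₁ * M₂) ≤ (ε / (M₁ * M₂ + 1)) * (M₁ * M₂) :=
          mul_le_mul_of_nonneg_right (le_of_lt hn) hM120
      _ < (ε / (M₁ * M₂ + 1)) * (M₁ * M₂ + 1) := by
          apply mul_lt_mul_of_pos_left hM12 hpos
      _ = ε := by field_simp
  have := key n
  linarith

end GibbsPAq

end Summit.Ventures.PercRepro2
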